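import Summits.BirchSwinnertonDyer.BirchSwinnertonDyer.Theorems.AlignedTransportAtTwoMainConjectureOfRankZeroBSDAtTwoCubicDepthDoorGenusCert
import Summits.BirchSwinnertonDyer.BirchSwinnertonDyer.Theorems.AlignedTransportAtTwoMainConjectureOfRankZeroBSDAtTwoCubicDoorsDeadSubcellClassNumberE
import Literature.NumberTheory.NumberFields.CubicFieldIntegers
import Literature.NumberTheory.NumberFields.CubicFieldResiduePrimes
import HarnessLib

/-!
# Route `AlignedTransportAtTwo`, crux C2 `MainConjectureOfRankZeroBSDAtTwo` (stmt-BirchSwinnertonDyer-22298):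
# `e₁ = ord₂ h(ℚ(β,√2)) = 1` IN THE KERNEL for the cubic `2`-torsion field of `⟨1, 1, 1, -6, -10⟩` (`N = 9139`, unit class `±7 (mod 16)`) — the odd genus certificate decided in `ℤ[θ]`

HONEST FRAMING (cell `bsd-f1-sign2`, WIDTH-5 attached prover seat `bsd-line-att-p4` gen 39 on line `birth` of the lead `bsd-line-att-p2`;
`--supports` stmt-BirchSwinnertonDyer-22298, closes nothing; BSD is NOT proved by any of this; the crux C2, its verdict «blocked-on
`Rank1Residual.GreenbergMuConjectureIrreducible`» and every registered stub are untouched).  THEOREMS ONLY (no `def`, no named fact, no instance, no `sorry`).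

WHAT.  `W = ⟨1, 1, 1, -6, -10⟩` (`Δ_min = −9139 = −13·19·37 ≡ 5 (mod 8)`, rank `0`) is a HARD-CORE seed of the u7 sub-cell: unit class `±7 (mod 16)` (`t = 3`) and genus
regime (β) (this seat's census `Cruxes/…/DEPTH-DOOR-CUSTOMERS-att-p4-g39.md`), so neither the layer-one unit door nor the depth door applies.  What the
kernel CAN record is the layer-one class-group datum: att-p3 g43's `classNumberPExp_one_adjoin_eq_one_of_genusCert_odd` with every displayed datum decided
in `𝓞_{ℚ(β)} = ℤ[θ]` (`θ = (92 − u − u²)/16`, `u = 4β`, `f = X³ − 5X² + 7X + 16`; att-p4 g38 `…CubicDoorsDeadSubcellClassNumberE` / `CubicDisc 9139`): `h = 1`, `2 ∤ d`,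
`N((π₁)) = 2` (`π₁ = 98 -43θ +7θ²`, residue map `θ ↦ 1` mod 2), the unit `ε = 327375687 -143488807θ 23362614θ²` with `ε + 1 ∈ (π₁)³` and `±ε` non-squares (residue map mod `17`, `θ ↦ 5`,
`ε ↦ 6`), and the ODD GENUS CERTIFICATE `x = 153 -63θ 10θ²`, `y = 103 -48θ 8θ²`, `α = -45 -20θ 17θ²` (norm `-7`), `u = 327375687 -143488807θ 23362614θ²`: `x² − 2y² = uα²`, `m·α + 3·x = 1`,
`m'·α² + 25·2 = 1`, `α − 3 ∈ (π₁)³`.  THEN (★ `classNumberPExp_one_cubicField_n9139`) `e₁(κ) = 1` for every cyclotomic `ℤ₂`-extension `κ` of `ℚ(β)`.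
By the seat's Λ-reading (memo §3; census-grade) `μ₂ > 0` on a `t = 3` field forces `X ≅ 𝔽₂[[T]]`, i.e. `e₁ = 1` AND `A(K_n) ≅ (ℤ/2)^{2^n−1}` for all `n`;
this file supplies the first half as a theorem, so the μ-question for this seed is now EXACTLY the layer-two datum «`A(ℚ(β,θ₂)) ≅ (ℤ/2)³`?».
Nothing is asserted about `μ₂` or `MC₂` for this curve; BSD is NOT proved; nothing is closed.

References: [Gras2003] IV.4; [Serre1973CourseArithmetic] III §1.2; [NeukirchANT1999] I §7, III §1; [Cohen1993] Prop. 4.8.11; [LMFDB] nf 3.1.9139.1; tree: att-p3 g43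
`…CubicDepthDoorGenusCert` §4, att-p4 g38 `…CubicDoorsDeadSubcellClassNumberE`, `Literature/NumberTheory/CubicFields/CubicFieldDiscriminant9139*`, `MonicCubic.exists_ringHom_of_root`.
-/

set_option linter.dupNamespace false
set_option autoImplicit false

noncomputable section

open scoped Classical NumberField nonZeroDivisors IntermediateField

namespace Summit.BirchSwinnertonDyer.BirchSwinnertonDyer.Theorems.AlignedTransportAtTwoCubicGenusCertE1RowN9139

open NumberField IsDedekindDomain Polynomial WeierstrassCurve IntermediateField CongruenceSubgroup Module
  Literature.NumberTheory.IwasawaTheory Literature.NumberTheory.GaloisRepresentations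
  Literature.NumberTheory.GaloisRepresentations.Herbrand Literature.NumberTheory.GaloisRepresentations.MinkowskiUnit
  Literature.NumberTheory.GaloisRepresentations.CyclicNormIndex
  Literature.NumberTheory.EllipticCurves Literature.NumberTheory.EllipticCurves.Greenberg1999
  Literature.NumberTheory.EllipticCurves.ModularForms Literature.NumberTheory.EllipticCurves.Rank1Residual
  Literature.NumberTheory.EllipticCurves.Module
  Literature.NumberTheory.NumberFields Literature.NumberTheory.CubicFields
  Summit.BirchSwinnertonDyer.Rank1Residual Summit.BirchSwinnertonDyer.Rank1Residual.X1.MuLambda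
  Summit.BirchSwinnertonDyer.Rank1Residual.X5 Summit.BirchSwinnertonDyer.Rank1Residual.X5.O1
  Summit.BirchSwinnertonDyer.Rank1Residual.X5.Instances Summit.BirchSwinnertonDyer.Rank1Residual.F1Sign2
  Summit.BirchSwinnertonDyer.BirchSwinnertonDyer.Theorems.Rank1ResidualX1Defs
  Summit.BirchSwinnertonDyer.BirchSwinnertonDyer.Theses.AlignedTransportAtTwo
  Summit.BirchSwinnertonDyer.BirchSwinnertonDyer.Theorems.AlignedTransportAtTwoKilfordStratumShared
  Summit.BirchSwinnertonDyer.BirchSwinnertonDyer.Theorems.AlignedTransportAtTwoCubicCarrierRoad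
  Summit.BirchSwinnertonDyer.BirchSwinnertonDyer.Theorems.AlignedTransportAtTwoCubicLayerOneDoors
  Summit.BirchSwinnertonDyer.BirchSwinnertonDyer.Theorems.AlignedTransportAtTwoCubicDepthDoorGenusCert
  Summit.BirchSwinnertonDyer.BirchSwinnertonDyer.Theorems.AlignedTransportAtTwoCubicDoorsDeadSubcellClassNumberE

/-! ## §1 The residue maps of `𝓞_{ℚ(β)} = ℤ[θ]` used by the certificates -/

/-- A ring homomorphism `ψ : 𝓞_{ℚ(β)} → ℤ/17` with `ψ(θ) = 5` (`5` is a simple root of `f` mod `17`; `𝓞 = ℤ[θ] ≅ ℤ[X]/(f)`).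
[cite: Marcus2018, Ch. 3, Thm. 27] -/
theorem exists_residueHom_17 {β : AlgebraicClosure ℚ} (hβ : aeval β ((⟨1, 1, 1, -6, -10⟩ : WeierstrassCurve ℤ).baseChange ℚ).twoTorsionPolynomial.toPoly = 0) :
    ∃ ψ : 𝓞 ↥(IntermediateField.adjoin ℚ ({β} : Set (AlgebraicClosure ℚ))) →+* ZMod 17, ψ (MonicCubic.thetaInt (aeval_theta_n9139 hβ)) = (5 : ZMod 17) :=
  haveI : FiniteDimensional ℚ ↥(IntermediateField.adjoin ℚ ({β} : Set (AlgebraicClosure ℚ))) := IntermediateField.adjoin.finiteDimensional ((AlgebraicClosure.isAlgebraic ℚ).isAlgebraic β).isIntegral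
  haveI : NumberField ↥(IntermediateField.adjoin ℚ ({β} : Set (AlgebraicClosure ℚ))) := NumberField.mk
  MonicCubic.exists_ringHom_of_root CubicDisc9139.irreducible_polyQ (aeval_theta_n9139 hβ) (finrank_cubicField_n9139 hβ)
    CubicDisc9139.isUnit_of_disc_eq_sq_mul (5 : ZMod 17) (by decide)

/-- A ring homomorphism `ψ₂ : 𝓞_{ℚ(β)} → ℤ/2` with `ψ₂(θ) = −1 = 1` (the degree-one dyadic prime `𝔭₁ = (2, θ + 1)`). [cite: Marcus2018, Ch. 3, Thm. 27] -/
theorem exists_residueHom_two {β : AlgebraicClosure ℚ} (hβ : aeval β ((⟨1, 1, 1, -6, -10⟩ : WeierstrassCurve ℤ).baseChange ℚ).twoTorsionPolynomial.toPoly = 0) :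
    ∃ ψ : 𝓞 ↥(IntermediateField.adjoin ℚ ({β} : Set (AlgebraicClosure ℚ))) →+* ZMod 2, ψ (MonicCubic.thetaInt (aeval_theta_n9139 hβ)) = (((0) : ℤ) : ZMod 2) :=
  haveI : FiniteDimensional ℚ ↥(IntermediateField.adjoin ℚ ({β} : Set (AlgebraicClosure ℚ))) := IntermediateField.adjoin.finiteDimensional ((AlgebraicClosure.isAlgebraic ℚ).isAlgebraic β).isIntegral
  haveI : NumberField ↥(IntermediateField.adjoin ℚ ({β} : Set (AlgebraicClosure ℚ))) := NumberField.mk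
  MonicCubic.exists_ringHom_of_root CubicDisc9139.irreducible_polyQ (aeval_theta_n9139 hβ) (finrank_cubicField_n9139 hβ)
    CubicDisc9139.isUnit_of_disc_eq_sq_mul (((0) : ℤ) : ZMod 2) (by decide)

/-- **`N((π₁)) = 2`** for `π₁ = 98 -43θ +7θ²`: `(π₁) = (2, θ + 1)` (att-p4 g38) is the kernel of `ψ₂` (Dedekind–Kummer), of index `2`.
[cite: Marcus2018, Ch. 3, Thm. 27] [cite: LMFDB, number field 3.1.9139.1] -/
theorem absNorm_span_pi1_n9139 {β : AlgebraicClosure ℚ} (hβ : aeval β ((⟨1, 1, 1, -6, -10⟩ : WeierstrassCurve ℤ).baseChange ℚ).twoTorsionPolynomial.toPoly = 0) :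
    haveI : FiniteDimensional ℚ ↥(IntermediateField.adjoin ℚ ({β} : Set (AlgebraicClosure ℚ))) := IntermediateField.adjoin.finiteDimensional ((AlgebraicClosure.isAlgebraic ℚ).isAlgebraic β).isIntegral
    haveI : NumberField ↥(IntermediateField.adjoin ℚ ({β} : Set (AlgebraicClosure ℚ))) := NumberField.mk
    Ideal.absNorm (Ideal.span {((98 : 𝓞 ↥(IntermediateField.adjoin ℚ ({β} : Set (AlgebraicClosure ℚ)))) + (-43 : 𝓞 ↥(IntermediateField.adjoin ℚ ({β} : Set (AlgebraicClosure ℚ)))) * MonicCubic.thetaInt (aeval_theta_n9139 hβ) + (7 : 𝓞 ↥(IntermediateField.adjoin ℚ ({β} : Set (AlgebraicClosure ℚ)))) * MonicCubic.thetaInt (aeval_theta_n9139 hβ) ^ 2)}) = 2 := by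
  haveI : FiniteDimensional ℚ ↥(IntermediateField.adjoin ℚ ({β} : Set (AlgebraicClosure ℚ))) := IntermediateField.adjoin.finiteDimensional ((AlgebraicClosure.isAlgebraic ℚ).isAlgebraic β).isIntegral
  haveI : NumberField ↥(IntermediateField.adjoin ℚ ({β} : Set (AlgebraicClosure ℚ))) := NumberField.mk
  haveI : Fact (Nat.Prime 2) := ⟨Nat.prime_two⟩
  have hθ := aeval_theta_n9139 hβ
  have h3 := finrank_cubicField_n9139 hβ
  obtain ⟨ψ, hψ⟩ := exists_residueHom_two hβ
  have hexp : ¬ 2 ∣ RingOfIntegers.exponent (MonicCubic.thetaInt hθ) := by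
    rw [MonicCubic.exponent_thetaInt CubicDisc9139.irreducible_polyQ hθ h3 CubicDisc9139.isUnit_of_disc_eq_sq_mul]; decide
  have hker := MonicCubic.ker_residueHom_eq_span CubicDisc9139.irreducible_polyQ hθ hexp ψ hψ
  have hspan : Ideal.span {((2 : ℕ) : 𝓞 ↥(IntermediateField.adjoin ℚ ({β} : Set (AlgebraicClosure ℚ)))), MonicCubic.thetaInt hθ - (((0) : ℤ) : 𝓞 ↥(IntermediateField.adjoin ℚ ({β} : Set (AlgebraicClosure ℚ))))} = Ideal.span {((98 : 𝓞 ↥(IntermediateField.adjoin ℚ ({β} : Set (AlgebraicClosure ℚ)))) + (-43 : 𝓞 ↥(IntermediateField.adjoin ℚ ({β} : Set (AlgebraicClosure ℚ)))) * MonicCubic.thetaInt hθ + (7 : 𝓞 ↥(IntermediateField.adjoin ℚ ({β} : Set (AlgebraicClosure ℚ)))) * MonicCubic.thetaInt hθ ^ 2)} := by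
    rw [Nat.cast_ofNat, show MonicCubic.thetaInt hθ - (((0) : ℤ) : 𝓞 ↥(IntermediateField.adjoin ℚ ({β} : Set (AlgebraicClosure ℚ)))) = MonicCubic.thetaInt hθ by push_cast; ring,
      show ((98 : 𝓞 ↥(IntermediateField.adjoin ℚ ({β} : Set (AlgebraicClosure ℚ)))) + (-43 : 𝓞 ↥(IntermediateField.adjoin ℚ ({β} : Set (AlgebraicClosure ℚ)))) * MonicCubic.thetaInt hθ + (7 : 𝓞 ↥(IntermediateField.adjoin ℚ ({β} : Set (AlgebraicClosure ℚ)))) * MonicCubic.thetaInt hθ ^ 2) = 98 - 43 * MonicCubic.thetaInt hθ + 7 * MonicCubic.thetaInt hθ ^ 2 by ring]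
    exact CubicDisc9139.span_2_lin0_eq hθ
  rw [← hspan, ← hker]
  exact absNorm_ker_zmod ψ


/-! ## §2 `e₁ = 1` for the cubic field of discriminant `−9139` — UNCONDITIONAL -/

/-- **`e₁ = ord₂ h(ℚ(β,√2)) = 1`** for the cubic field of discriminant `−9139` (every cyclotomic `κ`): the odd genus certificate alone
(att-p3 g43's `classNumberPExp_one_adjoin_eq_one_of_genusCert_odd`). [cite: Gras2003, IV.4] [cite: Serre1973CourseArithmetic, Ch. III §1.2, Thm. 1]
[cite: LMFDB, number field 3.1.9139.1 (class number 1)] -/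
theorem classNumberPExp_one_cubicField_n9139 {β : AlgebraicClosure ℚ} (hβ : aeval β ((⟨1, 1, 1, -6, -10⟩ : WeierstrassCurve ℤ).baseChange ℚ).twoTorsionPolynomial.toPoly = 0)
    (κP : ZpExtension ↥(IntermediateField.adjoin ℚ ({β} : Set (AlgebraicClosure ℚ))) 2) (hκP : κP.IsCyclotomic) :
    classNumberPExp κP 1 = 1 := by
  haveI := isElliptic_n9139
  haveI := isGloballyMinimal_n9139
  haveI : FiniteDimensional ℚ ↥(IntermediateField.adjoin ℚ ({β} : Set (AlgebraicClosure ℚ))) := IntermediateField.adjoin.finiteDimensional ((AlgebraicClosure.isAlgebraic ℚ).isAlgebraic β).isIntegral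
  haveI : NumberField ↥(IntermediateField.adjoin ℚ ({β} : Set (AlgebraicClosure ℚ))) := NumberField.mk
  have hord : IsOrdinaryAt ((⟨1, 1, 1, -6, -10⟩ : WeierstrassCurve ℤ).baseChange ℚ) 2 := goodOrd_two_n9139
  have ht := not_hasRationalTwoTorsionX_n9139
  have hθ := aeval_theta_n9139 hβ
  have h3 := finrank_cubicField_n9139 hβ
  have hd : ¬ (2 : ℤ) ∣ NumberField.discr ↥(IntermediateField.adjoin ℚ ({β} : Set (AlgebraicClosure ℚ))) := by
    rw [CubicDisc9139.discr_eq h3 hθ]; norm_num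
  obtain ⟨ψ, hψ⟩ := exists_residueHom_17 hβ
  set θI : 𝓞 ↥(IntermediateField.adjoin ℚ ({β} : Set (AlgebraicClosure ℚ))) := MonicCubic.thetaInt hθ with hθI
  have hrel : θI ^ 3 + (-5 : 𝓞 ↥(IntermediateField.adjoin ℚ ({β} : Set (AlgebraicClosure ℚ)))) * θI ^ 2 + (7 : 𝓞 ↥(IntermediateField.adjoin ℚ ({β} : Set (AlgebraicClosure ℚ)))) * θI + (16 : 𝓞 ↥(IntermediateField.adjoin ℚ ({β} : Set (AlgebraicClosure ℚ)))) = 0 := by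
    have h := MonicCubic.thetaInt_rel hθ
    push_cast at h
    linear_combination h
  have hεmul : ((327375687 : 𝓞 ↥(IntermediateField.adjoin ℚ ({β} : Set (AlgebraicClosure ℚ)))) + (-143488807 : 𝓞 ↥(IntermediateField.adjoin ℚ ({β} : Set (AlgebraicClosure ℚ)))) * θI + (23362614 : 𝓞 ↥(IntermediateField.adjoin ℚ ({β} : Set (AlgebraicClosure ℚ)))) * θI ^ 2) * ((-8249 : 𝓞 ↥(IntermediateField.adjoin ℚ ({β} : Set (AlgebraicClosure ℚ)))) + (-6182 : 𝓞 ↥(IntermediateField.adjoin ℚ ({β} : Set (AlgebraicClosure ℚ)))) * θI + (913 : 𝓞 ↥(IntermediateField.adjoin ℚ ({β} : Set (AlgebraicClosure ℚ)))) * θI ^ 2) = 1 := by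
    linear_combination ((-168782627629 : 𝓞 ↥(IntermediateField.adjoin ℚ ({β} : Set (AlgebraicClosure ℚ)))) * θI ^ 0 + (21330066582 : 𝓞 ↥(IntermediateField.adjoin ℚ ({β} : Set (AlgebraicClosure ℚ)))) * θI ^ 1) * hrel
  have humul : ((327375687 : 𝓞 ↥(IntermediateField.adjoin ℚ ({β} : Set (AlgebraicClosure ℚ)))) + (-143488807 : 𝓞 ↥(IntermediateField.adjoin ℚ ({β} : Set (AlgebraicClosure ℚ)))) * θI + (23362614 : 𝓞 ↥(IntermediateField.adjoin ℚ ({β} : Set (AlgebraicClosure ℚ)))) * θI ^ 2) * ((-8249 : 𝓞 ↥(IntermediateField.adjoin ℚ ({β} : Set (AlgebraicClosure ℚ)))) + (-6182 : 𝓞 ↥(IntermediateField.adjoin ℚ ({β} : Set (AlgebraicClosure ℚ)))) * θI + (913 : 𝓞 ↥(IntermediateField.adjoin ℚ ({β} : Set (AlgebraicClosure ℚ)))) * θI ^ 2) = 1 := by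
    linear_combination ((-168782627629 : 𝓞 ↥(IntermediateField.adjoin ℚ ({β} : Set (AlgebraicClosure ℚ)))) * θI ^ 0 + (21330066582 : 𝓞 ↥(IntermediateField.adjoin ℚ ({β} : Set (AlgebraicClosure ℚ)))) * θI ^ 1) * hrel
  have hψε : ψ ((327375687 : 𝓞 ↥(IntermediateField.adjoin ℚ ({β} : Set (AlgebraicClosure ℚ)))) + (-143488807 : 𝓞 ↥(IntermediateField.adjoin ℚ ({β} : Set (AlgebraicClosure ℚ)))) * θI + (23362614 : 𝓞 ↥(IntermediateField.adjoin ℚ ({β} : Set (AlgebraicClosure ℚ)))) * θI ^ 2) = (6 : ZMod 17) := by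
    simp only [map_add, map_mul, map_pow, map_ofNat, map_neg, hψ]
    decide
  have hnsq : ∀ z : (𝓞 ↥(IntermediateField.adjoin ℚ ({β} : Set (AlgebraicClosure ℚ))))ˣ, Units.mkOfMulEqOne _ _ hεmul ≠ z ^ 2 ∧ Units.mkOfMulEqOne _ _ hεmul ≠ -z ^ 2 := by
    intro z
    refine ⟨fun h => ?_, fun h => ?_⟩
    · have h' := congrArg (fun w : (𝓞 ↥(IntermediateField.adjoin ℚ ({β} : Set (AlgebraicClosure ℚ))))ˣ => ψ (w : 𝓞 ↥(IntermediateField.adjoin ℚ ({β} : Set (AlgebraicClosure ℚ))))) h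
      simp only [Units.val_mkOfMulEqOne, Units.val_pow_eq_pow_val, map_pow] at h'
      rw [hψε] at h'
      exact absurd h'.symm (by generalize ψ (z : 𝓞 ↥(IntermediateField.adjoin ℚ ({β} : Set (AlgebraicClosure ℚ)))) = t; revert t; decide)
    · have h' := congrArg (fun w : (𝓞 ↥(IntermediateField.adjoin ℚ ({β} : Set (AlgebraicClosure ℚ))))ˣ => ψ (w : 𝓞 ↥(IntermediateField.adjoin ℚ ({β} : Set (AlgebraicClosure ℚ))))) h
      simp only [Units.val_mkOfMulEqOne, Units.val_neg, Units.val_pow_eq_pow_val, map_neg, map_pow] at h'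
      rw [hψε] at h'
      exact absurd h'.symm (by generalize ψ (z : 𝓞 ↥(IntermediateField.adjoin ℚ ({β} : Set (AlgebraicClosure ℚ)))) = t; revert t; decide)
  have hε : (Units.mkOfMulEqOne _ _ hεmul : (𝓞 ↥(IntermediateField.adjoin ℚ ({β} : Set (AlgebraicClosure ℚ))))ˣ).val - 1 ∈ Ideal.span {((98 : 𝓞 ↥(IntermediateField.adjoin ℚ ({β} : Set (AlgebraicClosure ℚ)))) + (-43 : 𝓞 ↥(IntermediateField.adjoin ℚ ({β} : Set (AlgebraicClosure ℚ)))) * θI + (7 : 𝓞 ↥(IntermediateField.adjoin ℚ ({β} : Set (AlgebraicClosure ℚ)))) * θI ^ 2)} ^ 3 ∨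
      (Units.mkOfMulEqOne _ _ hεmul : (𝓞 ↥(IntermediateField.adjoin ℚ ({β} : Set (AlgebraicClosure ℚ))))ˣ).val + 1 ∈ Ideal.span {((98 : 𝓞 ↥(IntermediateField.adjoin ℚ ({β} : Set (AlgebraicClosure ℚ)))) + (-43 : 𝓞 ↥(IntermediateField.adjoin ℚ ({β} : Set (AlgebraicClosure ℚ)))) * θI + (7 : 𝓞 ↥(IntermediateField.adjoin ℚ ({β} : Set (AlgebraicClosure ℚ)))) * θI ^ 2)} ^ 3 := by
    refine Or.inr ?_
    rw [Units.val_mkOfMulEqOne, Ideal.span_singleton_pow, Ideal.mem_span_singleton']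
    exact ⟨((-205 : 𝓞 ↥(IntermediateField.adjoin ℚ ({β} : Set (AlgebraicClosure ℚ)))) + (-232 : 𝓞 ↥(IntermediateField.adjoin ℚ ({β} : Set (AlgebraicClosure ℚ)))) * θI + (59 : 𝓞 ↥(IntermediateField.adjoin ℚ ({β} : Set (AlgebraicClosure ℚ)))) * θI ^ 2), by linear_combination ((-32520003 : 𝓞 ↥(IntermediateField.adjoin ℚ ({β} : Set (AlgebraicClosure ℚ)))) * θI ^ 0 + (25421879 : 𝓞 ↥(IntermediateField.adjoin ℚ ({β} : Set (AlgebraicClosure ℚ)))) * θI ^ 1 + (-10858837 : 𝓞 ↥(IntermediateField.adjoin ℚ ({β} : Set (AlgebraicClosure ℚ)))) * θI ^ 2 + (2638713 : 𝓞 ↥(IntermediateField.adjoin ℚ ({β} : Set (AlgebraicClosure ℚ)))) * θI ^ 3 + (-351330 : 𝓞 ↥(IntermediateField.adjoin ℚ ({β} : Set (AlgebraicClosure ℚ)))) * θI ^ 4 + (20237 : 𝓞 ↥(IntermediateField.adjoin ℚ ({β} : Set (AlgebraicClosure ℚ)))) * θI ^ 5) * hrel⟩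
  have hxy : ((153 : 𝓞 ↥(IntermediateField.adjoin ℚ ({β} : Set (AlgebraicClosure ℚ)))) + (-63 : 𝓞 ↥(IntermediateField.adjoin ℚ ({β} : Set (AlgebraicClosure ℚ)))) * θI + (10 : 𝓞 ↥(IntermediateField.adjoin ℚ ({β} : Set (AlgebraicClosure ℚ)))) * θI ^ 2) ^ 2 - 2 * ((103 : 𝓞 ↥(IntermediateField.adjoin ℚ ({β} : Set (AlgebraicClosure ℚ)))) + (-48 : 𝓞 ↥(IntermediateField.adjoin ℚ ({β} : Set (AlgebraicClosure ℚ)))) * θI + (8 : 𝓞 ↥(IntermediateField.adjoin ℚ ({β} : Set (AlgebraicClosure ℚ)))) * θI ^ 2) ^ 2 = (Units.mkOfMulEqOne _ _ humul : (𝓞 ↥(IntermediateField.adjoin ℚ ({β} : Set (AlgebraicClosure ℚ))))ˣ).val * ((-45 : 𝓞 ↥(IntermediateField.adjoin ℚ ({β} : Set (AlgebraicClosure ℚ)))) + (-20 : 𝓞 ↥(IntermediateField.adjoin ℚ ({β} : Set (AlgebraicClosure ℚ)))) * θI + (17 : 𝓞 ↥(IntermediateField.adjoin ℚ ({β} : Set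 (AlgebraicClosure ℚ)))) * θI ^ 2) ^ 2 := by
    rw [Units.val_mkOfMulEqOne]
    linear_combination ((-41433485249 : 𝓞 ↥(IntermediateField.adjoin ℚ ({β} : Set (AlgebraicClosure ℚ)))) * θI ^ 0 + (-542312824 : 𝓞 ↥(IntermediateField.adjoin ℚ ({β} : Set (AlgebraicClosure ℚ)))) * θI ^ 1 + (23595865513 : 𝓞 ↥(IntermediateField.adjoin ℚ ({β} : Set (AlgebraicClosure ℚ)))) * θI ^ 2 + (-6751795446 : 𝓞 ↥(IntermediateField.adjoin ℚ ({β} : Set (AlgebraicClosure ℚ)))) * θI ^ 3) * hrel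
  have hbez : ((2123570 : 𝓞 ↥(IntermediateField.adjoin ℚ ({β} : Set (AlgebraicClosure ℚ)))) + (-930761 : 𝓞 ↥(IntermediateField.adjoin ℚ ({β} : Set (AlgebraicClosure ℚ)))) * θI + (151545 : 𝓞 ↥(IntermediateField.adjoin ℚ ({β} : Set (AlgebraicClosure ℚ)))) * θI ^ 2) * ((-45 : 𝓞 ↥(IntermediateField.adjoin ℚ ({β} : Set (AlgebraicClosure ℚ)))) + (-20 : 𝓞 ↥(IntermediateField.adjoin ℚ ({β} : Set (AlgebraicClosure ℚ)))) * θI + (17 : 𝓞 ↥(IntermediateField.adjoin ℚ ({β} : Set (AlgebraicClosure ℚ)))) * θI ^ 2) + (3 : 𝓞 ↥(IntermediateField.adjoin ℚ ({β} : Set (AlgebraicClosure ℚ)))) * ((153 : 𝓞 ↥(IntermediateField.adjoin ℚ ({β} : Set (AlgebraicClosure ℚ)))) + (-63 : 𝓞 ↥(IntermediateField.adjoin ℚ ({β} : Set (AlgebraicClosure ℚ)))) * θI + (10 : 𝓞 ↥(IntermediateField.adjoin ℚ ({β} : Set (AlgebraicClosure ℚ)))) * θI ^ 2) = 1 := by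
    linear_combination ((-5972512 : 𝓞 ↥(IntermediateField.adjoin ℚ ({β} : Set (AlgebraicClosure ℚ)))) * θI ^ 0 + (2576265 : 𝓞 ↥(IntermediateField.adjoin ℚ ({β} : Set (AlgebraicClosure ℚ)))) * θI ^ 1) * hrel
  have hbez' : ((-692795305 : 𝓞 ↥(IntermediateField.adjoin ℚ ({β} : Set (AlgebraicClosure ℚ)))) + (303652274 : 𝓞 ↥(IntermediateField.adjoin ℚ ({β} : Set (AlgebraicClosure ℚ)))) * θI + (-49440169 : 𝓞 ↥(IntermediateField.adjoin ℚ ({β} : Set (AlgebraicClosure ℚ)))) * θI ^ 2) * ((-45 : 𝓞 ↥(IntermediateField.adjoin ℚ ({β} : Set (AlgebraicClosure ℚ)))) + (-20 : 𝓞 ↥(IntermediateField.adjoin ℚ ({β} : Set (AlgebraicClosure ℚ)))) * θI + (17 : 𝓞 ↥(IntermediateField.adjoin ℚ ({β} : Set (AlgebraicClosure ℚ)))) * θI ^ 2) ^ 2 + (25 : 𝓞 ↥(IntermediateField.adjoin ℚ ({β} : Set (AlgebraicClosure ℚ)))) * 2 = 1 := by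
    linear_combination ((-87681905786 : 𝓞 ↥(IntermediateField.adjoin ℚ ({β} : Set (AlgebraicClosure ℚ)))) * θI ^ 0 + (-1147647103 : 𝓞 ↥(IntermediateField.adjoin ℚ ({β} : Set (AlgebraicClosure ℚ)))) * θI ^ 1 + (49933777901 : 𝓞 ↥(IntermediateField.adjoin ℚ ({β} : Set (AlgebraicClosure ℚ)))) * θI ^ 2 + (-14288208841 : 𝓞 ↥(IntermediateField.adjoin ℚ ({β} : Set (AlgebraicClosure ℚ)))) * θI ^ 3) * hrel
  have hα : ((-45 : 𝓞 ↥(IntermediateField.adjoin ℚ ({β} : Set (AlgebraicClosure ℚ)))) + (-20 : 𝓞 ↥(IntermediateField.adjoin ℚ ({β} : Set (AlgebraicClosure ℚ)))) * θI + (17 : 𝓞 ↥(IntermediateField.adjoin ℚ ({β} : Set (AlgebraicClosure ℚ)))) * θI ^ 2) - 3 ∈ Ideal.span {((98 : 𝓞 ↥(IntermediateField.adjoin ℚ ({β} : Set (AlgebraicClosure ℚ)))) + (-43 : 𝓞 ↥(IntermediateField.adjoin ℚ ({β} : Set (AlgebraicClosure ℚ)))) * θI + (7 : 𝓞 ↥(IntermediateField.adjoin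 ℚ ({β} : Set (AlgebraicClosure ℚ)))) * θI ^ 2)} ^ 3 ∨ ((-45 : 𝓞 ↥(IntermediateField.adjoin ℚ ({β} : Set (AlgebraicClosure ℚ)))) + (-20 : 𝓞 ↥(IntermediateField.adjoin ℚ ({β} : Set (AlgebraicClosure ℚ)))) * θI + (17 : 𝓞 ↥(IntermediateField.adjoin ℚ ({β} : Set (AlgebraicClosure ℚ)))) * θI ^ 2) + 3 ∈ Ideal.span {((98 : 𝓞 ↥(IntermediateField.adjoin ℚ ({β} : Set (AlgebraicClosure ℚ)))) + (-43 : 𝓞 ↥(IntermediateField.adjoin ℚ ({β} : Set (AlgebraicClosure ℚ)))) * θI + (7 : 𝓞 ↥(IntermediateField.adjoin ℚ ({β} : Set (AlgebraicClosure ℚ)))) * θI ^ 2)} ^ 3 := by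
    refine Or.inl ?_
    rw [Ideal.span_singleton_pow, Ideal.mem_span_singleton']
    exact ⟨((11842 : 𝓞 ↥(IntermediateField.adjoin ℚ ({β} : Set (AlgebraicClosure ℚ)))) + (-162 : 𝓞 ↥(IntermediateField.adjoin ℚ ({β} : Set (AlgebraicClosure ℚ)))) * θI + (-9225 : 𝓞 ↥(IntermediateField.adjoin ℚ ({β} : Set (AlgebraicClosure ℚ)))) * θI ^ 2), by linear_combination ((696599732 : 𝓞 ↥(IntermediateField.adjoin ℚ ({β} : Set (AlgebraicClosure ℚ)))) * θI ^ 0 + (-1231244655 : 𝓞 ↥(IntermediateField.adjoin ℚ ({β} : Set (AlgebraicClosure ℚ)))) * θI ^ 1 + (777852725 : 𝓞 ↥(IntermediateField.adjoin ℚ ({β} : Set (AlgebraicClosure ℚ)))) * θI ^ 2 + (-251683922 : 𝓞 ↥(IntermediateField.adjoin ℚ ({β} : Set (AlgebraicClosure ℚ)))) * θI ^ 3 + (42434784 : 𝓞 ↥(IntermediateField.adjoin ℚ ({β} : Set (AlgebraicClosure ℚ)))) * θI ^ 4 + (-3164175 : 𝓞 ↥(IntermediateField.adjoin ℚ ({β}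 : Set (AlgebraicClosure ℚ)))) * θI ^ 5) * hrel⟩
  exact classNumberPExp_one_adjoin_eq_one_of_genusCert_odd ((⟨1, 1, 1, -6, -10⟩ : WeierstrassCurve ℤ).baseChange ℚ) hord ht minimalDiscriminantInt_emod_eight_n9139 Δ_n9139_neg hβ
    (not_two_dvd_classNumber_cubicField_n9139 hβ) hd (Ideal.span {((98 : 𝓞 ↥(IntermediateField.adjoin ℚ ({β} : Set (AlgebraicClosure ℚ)))) + (-43 : 𝓞 ↥(IntermediateField.adjoin ℚ ({β} : Set (AlgebraicClosure ℚ)))) * θI + (7 : 𝓞 ↥(IntermediateField.adjoin ℚ ({β} : Set (AlgebraicClosure ℚ)))) * θI ^ 2)}) (absNorm_span_pi1_n9139 hβ) hε hnsq hxy hbez hbez' hα κP hκP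

end Summit.BirchSwinnertonDyer.BirchSwinnertonDyer.Theorems.AlignedTransportAtTwoCubicGenusCertE1RowN9139

end
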